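import Literature.AnabelianGeometry.EtaleTheta.TemperedFrobenioidCor38Sub
import Literature.AnabelianGeometry.EtaleTheta.TemperedFrobenioidToy
import Literature.AlgebraicGeometry.Frobenioids.MonoidFunctors
import Mathlib.CategoryTheory.SingleObj
import HarnessLib

/-!
# [EtTh] Cor. 3.8 sub-DAG row C38-L01 (`Cor38Hyp.StandardIsotropicNotGroupLike`): its universal closure
# over the typed hypothesis record is FALSE — a tempered-Frobenioid structure whose vocabulary says
# "non-dilating" while its divisor monoid IS dilating (kernel certificate)

S. Mochizuki, *The étale theta function and its Frobenioid-theoretic manifestations*, Publ. RIMS **45**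
(2009) [MochizukiEtTh2009], §3: proof of Corollary 3.8, PDF p. 81 l. 1–2: "by Theorem 3.7, (i), (ii),
`C₁`, `C₂` are of standard and isotropic type, but not of group-like type" [cite: MochizukiEtTh2009, Cor 3.8 p.81];
[FrdI] Def. 1.1 (i)/(ii) (non-dilating endomorphisms / monoids), Def. 3.1 (i) (standard type, clause
"`Φ` non-dilating") [cite: MochizukiFrdI2008, Def. 3.1 (i) p.56].

abc-iut cell, block F (FACT-LIST fact-proving wave), seat abc-iut-f-015; row **F-2808**
`Cor38Hyp.StandardIsotropicNotGroupLike` of `TemperedFrobenioidCor38Sub.lean` (abc-iut-w5-d124's sub-DAG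
row C38-L01: `PreFrobenioidData.Thm42Setting C₁.opsData C₂.opsData` — the REAL [FrdI] predicates "of
standard / isotropic / not group-like type" for both tempered Frobenioids of a record `h : Cor38Hyp C₁ C₂`).

What the kernel certifies here.  "Of standard type" ([FrdI] Def. 3.1 (i), `PreFrobenioidData.IsOfStandardType`)
contains clause (e) "`Φ` non-dilating" as the tree's REAL predicate (`PreFrobenioidData.IsNonDilatingOn`:
every pull-back `α^*` along an endomorphism of the base is non-dilating, [FrdI] Def. 1.1 (i):
"`α^char = id` whenever `α^char(a) ≼ a` for all primary `a`"), whereas the typed record `Cor38Hyp` records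
"`Φ_i` non-dilating" only through the VOCABULARY STUB `V.IsNonDilating` of `FrdIMonoidStub` (abc-iut-L2-t3;
`True` in the trivial vocabulary `Toy.monoidVocab`).  We build Def. 3.3 (iii) / 3.6 (i) / 3.6 (ii) data
over the trivial vocabularies whose base `D = D₀` is the ONE-object category `SingleObj (ℚ≥0)ˣ`
(automorphism group `ℚ_{>0}`; connected, totally epimorphic, of FSM- hence FSMFF-type), with
`Φ = Φ^{ℝ-log} = ℚ_{≥0}` (ℚ-monoprime — it is its own `Φ^{bs-fld}`, `ℝ·Φ₀^cnst := ` everything) on which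
`u ∈ ℚ_{>0}` acts by `q ↦ u·q`, `B = B₀^Λ = (ℚ_{≥0})^gp`, `Div = id`, `F₀^Λ = ` everything — every typed
field holds (`DilatingToy.C`).  The pull-back along the automorphism `2` is the DOUBLING of `ℚ_{≥0}`:
`2a ≼ a` for every `a` but `2a ≠ a` for `a ≠ 0`, so it is dilating (`DilatingToy.not_isNonDilating_pull_two`),
`C.opsData` is not of standard type, and

* **`DilatingToy.not_standardIsotropicNotGroupLike : ¬ hyp.StandardIsotropicNotGroupLike`** at the
  record `hyp : Cor38Hyp C C` (`Ψ = 𝟭`, FSMFF base, vocabulary "non-dilating");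
* `Cor38Hyp.not_forall_standardIsotropicNotGroupLike` — the universal closure of F-2808 (universe
  level `0`) is FALSE.

Reading (cell vocabulary, R5): the row is admissible only as its instance forms —
`Cor38Hyp.standardIsotropicNotGroupLike_treeCatVocab` (canonical vocabulary, given `hBmon`) and
`standardIsotropicNotGroupLike_of_hypotheses` (given the [FrdI] Thm. 5.2 hypotheses AND the REAL
`IsNonDilatingOn Φ_i`), abc-iut `Discharge/Sec3Cor38StdIsoNotGL.lean`.  The gap exhibited is a SCHEMA gap
of OUR typed interfaces (a vocabulary stub is not the [FrdI] predicate it names), in the line of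
`TemperedFrobenioidToyFinv.lean` / `TemperedFrobenioidToyTwoPrimes.lean`; it says nothing about the tempered
Frobenioids of a curve (whose `Φ` is non-dilating by [EtTh] Prop. 3.4 (i)) or about Cor. 3.8 as printed.
HONEST FRAMING: refereed pre-IUT material; nothing here bears on the disputed [IUTchIII] Cor. 3.12; no
side taken.
-/

noncomputable section

namespace Literature.AnabelianGeometry.EtaleTheta

open CategoryTheory Opposite Literature.AlgebraicGeometry.Frobenioids

namespace DilatingToy

/-! ### §1 The base `SingleObj (ℚ≥0)ˣ` and the scaling action on `ℚ_{≥0}` -/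

/-- The one-object base category with automorphism group `ℚ_{>0} = (ℚ≥0)ˣ`.
[cite: MochizukiEtTh2009, Def 3.6 p.77] -/
abbrev Base : Type := SingleObj NNRatˣ

/-- The divisor monoid `ℚ_{≥0}` (multiplicative notation). [cite: MochizukiEtTh2009, Def 3.3 p.73] -/
abbrev M : Type := Multiplicative NNRat

/-- The action of `u ∈ ℚ_{>0}` on `ℚ_{≥0}`: `q ↦ u·q`. [cite: MochizukiEtTh2009, Def 3.6 p.76] -/
def scale (u : NNRatˣ) : M →* M := ((AddMonoidHom.mulLeft (u : NNRat))).toMultiplicative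

/-- Values of `scale`. [cite: MochizukiEtTh2009, Def 3.6 p.76] -/
theorem scale_apply (u : NNRatˣ) (x : M) :
    scale u x = Multiplicative.ofAdd ((u : NNRat) * Multiplicative.toAdd x) := rfl

/-- `1` acts trivially. [cite: MochizukiEtTh2009, Def 3.6 p.76] -/
theorem scale_one : scale 1 = MonoidHom.id M :=
  MonoidHom.ext fun x => by
    rw [scale_apply, Units.val_one, one_mul]
    rfl

/-- The action is multiplicative (the group is commutative, so in either order).
[cite: MochizukiEtTh2009, Def 3.6 p.76] -/
theorem scale_mul (u v : NNRatˣ) : scale (u * v) = (scale v).comp (scale u) :=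
  MonoidHom.ext fun x => by
    rw [MonoidHom.comp_apply, scale_apply, scale_apply, scale_apply, Units.val_mul, toAdd_ofAdd, ← mul_assoc,
      mul_comm (v : NNRat)]

/-- `Φ₀ = Φ₀^ℝ := ℚ_{≥0}` as a monoid on the base, `u` acting by `q ↦ u·q`.
[cite: MochizukiEtTh2009, Def 3.6 p.76] -/
def ΦR : Baseᵒᵖ ⥤ CommMonCat.{0} where
  obj _ := CommMonCat.of M
  map f := CommMonCat.ofHom (scale f.unop)
  map_id X := by
    apply CommMonCat.hom_ext
    exact scale_one
  map_comp f g := by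
    apply CommMonCat.hom_ext
    exact scale_mul (show NNRatˣ from f.unop) (show NNRatˣ from g.unop)

/-! ### §2 The typed data: Def. 3.3 (iii), Def. 3.6 (i), Def. 3.6 (ii) -/

/-- Def. 3.3 (iii) data: `Φ₀ = ℚ_{≥0}` with the scaling action, `B₀ = Φ₀^gp`, `div₀ = id`, `F₀ = B₀`, nothing
cuspidal. [cite: MochizukiEtTh2009, Def 3.3 p.73] -/
def divisorMonoids : DivisorMonoids.{0, 0, 0} Base where
  Φ₀ := ΦR
  B₀ := groupificationFunctor ΦR
  isUnit_B₀ _ b := by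
    change IsUnit (M := Algebra.GrothendieckGroup M) b
    exact Group.isUnit _
  div₀ _ := MonoidHom.id _
  div₀_natural _ _ := rfl
  F₀ _ := ⊤
  F₀_map _ _ _ := trivial
  ncsp₀ _ := ⊤
  csp₀ _ := ⊥
  ncsp₀_map _ _ _ := trivial
  csp₀_map _ x hx := by
    rw [Submonoid.mem_bot] at hx ⊢
    rw [hx, map_one]
  existsUnique_ncsp_csp _ x := by
    refine ⟨(⟨x, trivial⟩, ⟨1, Submonoid.mem_bot.mpr rfl⟩), mul_one x, ?_⟩
    rintro ⟨a, c⟩ h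
    have hc : c.1 = 1 := Submonoid.mem_bot.mp c.2
    have ha : a.1 = x := by
      have h' : a.1 * c.1 = x := h
      rwa [hc, mul_one] at h'
    exact Prod.ext (Subtype.ext ha) (Subtype.ext hc)

/-- Def. 3.6 (i) data (`Φ₀^ℝ = Φ₀`, `B₀^Λ = (ℚ_{≥0})^gp`, `Div = id`, `F₀^Λ = B₀^Λ`, `ℝ·Φ₀^cnst =` everything),
over the trivial monoid vocabulary. [cite: MochizukiEtTh2009, Def 3.6 p.76] -/
def realified : RealifiedDivisorMonoids (D₀ := Base) Toy.monoidVocab where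
  toDivisorMonoids := divisorMonoids
  Λ := MonoidType.Z
  ΦR := ΦR
  toR _ := MonoidHom.id _
  toR_natural _ _ := rfl
  isRealification _ := trivial
  BΛ := groupificationFunctor ΦR
  isUnit_BΛ _ b := by
    change IsUnit (M := Algebra.GrothendieckGroup M) b
    exact Group.isUnit _
  divΛ _ := MonoidHom.id _
  divΛ_natural _ _ := rfl
  FΛ _ := ⊤
  FΛ_map _ _ _ := trivial
  cnstR _ := ⊤
  cnstR_map _ _ _ := trivial
  divΛ_mem_cnstR _ _ _ := trivial
  cnstR_root _ _ _ _ := trivial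
  cnst_le_cnstR _ _ _ := trivial
  ncspR _ := ⊤
  cspR _ := ⊥
  toR_ncsp _ _ _ := trivial
  toR_csp _ _ hx := hx

/-- The trivial [FrdI] category vocabulary on the base. [cite: MochizukiEtTh2009, Def 3.6 p.77] -/
def catVocab : FrdICatStub.{0, 0, 0} Base where
  IsDivisorialOn _ := True
  IsRational _ := True
  IsStrictlyRational _ := True

/-- `Φ^{bs-fld} = ℚ_{≥0} ∩ (everything) ≅ ℚ_{≥0}` (so it is ℚ-monoprime). [cite: MochizukiEtTh2009, Def 3.6 p.77] -/
def bsFldEquiv :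
    ↥((⊤ : Submonoid M) ⊓ ((⊤ : Subgroup (Algebra.GrothendieckGroup M))).toSubmonoid.comap
      Algebra.GrothendieckGroup.of) ≃* Multiplicative NNRat where
  toFun f := f.1
  invFun k := ⟨k, trivial, trivial⟩
  left_inv _ := rfl
  right_inv _ := rfl
  map_mul' _ _ := rfl

/-- `1 ≠ 0` in `ℚ_{≥0}`, multiplicatively. [folklore] -/
private theorem ofAdd_one_ne_one : (Multiplicative.ofAdd (1 : NNRat) : M) ≠ 1 :=
  fun h => one_ne_zero (Multiplicative.ofAdd.injective h)

/-- Every arrow of the base is invertible (one object, automorphism GROUP). [cite: MochizukiFrdI2008, §0 p.14] -/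
theorem isIso_base {X Y : Base} (f : X ⟶ Y) : IsIso f := IsIso.of_groupoid f

/-- **The typed tempered-Frobenioid interface is satisfied**: `D = D₀ = SingleObj ℚ_{>0}` (connected,
totally epimorphic), `Φ = Φ^{ℝ-log} = ℚ_{≥0}` (group-saturated), `Φ^{bs-fld} = ℚ_{≥0}` ℚ-monoprime (REAL
`IsMonoprime`), and Def. 3.6 (ii)(b): the constant `1 ∈ (ℚ_{≥0})^gp` has the nonzero divisor `1/0`.
[cite: MochizukiEtTh2009, Def 3.6 p.77] -/
def C : TemperedFrobenioid realified Base catVocab where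
  isConnected := zigzag_isConnected fun j₁ j₂ => by rw [Subsingleton.elim j₁ j₂]
  isTotallyEpimorphic := ⟨fun f => by haveI := isIso_base f; infer_instance⟩
  base := 𝟭 _
  Φ := ⟨fun _ => ⊤, fun _ _ _ => trivial⟩
  isGroupSaturated A := (isGroupSaturated_iff' _).2 fun _ _ _ _ _ _ => trivial
  isPerfFactorial _ := trivial
  isDivisorialOn := trivial
  isMonoprime_bsFld _ := IsMonoprime.ofQ ⟨⟨bsFldEquiv⟩⟩
  exists_FΛ_div_ne _ := ⟨Algebra.GrothendieckGroup.of (Multiplicative.ofAdd (1 : NNRat)), trivial,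
    Multiplicative.ofAdd (1 : NNRat), trivial, 1, trivial, ofAdd_one_ne_one, by rw [map_one, div_one]; rfl⟩

/-! ### §3 The base automorphism `2` pulls back by DOUBLING: `Φ` is dilating -/

/-- The automorphism `2 ∈ ℚ_{>0}` of the object of the base. [cite: MochizukiEtTh2009, Def 3.6 p.77] -/
def two : (SingleObj.star NNRatˣ : Base) ⟶ SingleObj.star NNRatˣ := Units.mk0 (2 : NNRat) two_ne_zero

/-- The pull-back of `Φ = ℚ_{≥0}` along `2` is doubling (squaring, multiplicatively): `2^*(a) = a·a`.
[cite: MochizukiFrdI2008, Def. 1.1(i)] -/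
theorem pull_two_apply (x : C.Φ.carrier (op (SingleObj.star NNRatˣ))) : C.Φ.pull two.op x = x * x := by
  apply Subtype.ext
  change Multiplicative.ofAdd ((2 : NNRat) * Multiplicative.toAdd (show M from x.1)) =
    (show M from x.1) * (show M from x.1)
  rw [two_mul, ofAdd_add, ofAdd_toAdd]

/-- **Doubling is dilating** ([FrdI] Def. 1.1 (i) negated for `2^*` on `ℚ_{≥0}`): `2^*(a) = a² ≼ a` for
every `a`, yet `2^*(1) = 2 ≠ 1` (the only unit of `ℚ_{≥0}` is `0`). Stated for the tree's
`PreFrobenioidData.IsNonDilating` (the form consumed by "standard type"). [cite: MochizukiFrdI2008, Def. 1.1(i)] -/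
theorem not_isNonDilating_pull_two : ¬ PreFrobenioidData.IsNonDilating (C.Φ.pull two.op) := by
  intro hnd
  have H : ∀ a : Associates (C.Φ.carrier (op (SingleObj.star NNRatˣ))),
      Precsim (associatesMap (C.Φ.pull two.op) a) a := by
    intro a
    obtain ⟨x, rfl⟩ := Associates.mk_surjective a
    refine ⟨2, two_pos, ?_⟩
    change Associates.mk (C.Φ.pull two.op x) ∣ Associates.mk x ^ 2
    rw [pull_two_apply, ← Associates.mk_pow, pow_two]
  let x₁ : C.Φ.carrier (op (SingleObj.star NNRatˣ)) := ⟨Multiplicative.ofAdd (1 : NNRat), trivial⟩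
  have h1 := hnd (fun a _ => H a) (Associates.mk x₁)
  change Associates.mk (C.Φ.pull two.op x₁) = Associates.mk x₁ at h1
  rw [pull_two_apply, Associates.mk_eq_mk_iff_associated] at h1
  obtain ⟨u, hu⟩ := h1
  have h2 := congrArg
    (fun m : C.Φ.carrier (op (SingleObj.star NNRatˣ)) => Multiplicative.toAdd (show M from m.1)) hu
  change (1 : NNRat) + 1 + Multiplicative.toAdd (show M from (u : C.Φ.carrier (op (SingleObj.star NNRatˣ))).1) = 1
    at h2
  rw [add_assoc] at h2
  have h3 : (1 : NNRat) +
      Multiplicative.toAdd (show M from (u : C.Φ.carrier (op (SingleObj.star NNRatˣ))).1) = 0 :=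
    add_left_cancel (h2.trans (add_zero (1 : NNRat)).symm)
  have h4 : (1 : NNRat) ≤ 0 :=
    calc (1 : NNRat) ≤ 1 + Multiplicative.toAdd (show M from (u : C.Φ.carrier (op (SingleObj.star NNRatˣ))).1) :=
        le_self_add
      _ = 0 := h3
  exact absurd h4 (not_le.mpr one_pos)

/-- The same for the tree's functorial [FrdI] predicate `Frobenioids.IsNonDilating` (Def. 1.1 (i) as in
`ElementaryFrobenioid.lean`): `Φ` is NOT a non-dilating monoid on the base.
[cite: MochizukiFrdI2008, Def. 1.1 (ii) p.19] -/
theorem not_isNonDilatingOn_divisorMonoid : ¬ IsNonDilatingOn C.divisorMonoid := by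
  intro h
  have h' := h (SingleObj.star NNRatˣ) two
  apply not_isNonDilating_pull_two
  intro hyp a
  have H : ∀ a : Associates (C.Φ.carrier (op (SingleObj.star NNRatˣ))),
      IsPrimary a → Precsim (associatesMap (C.Φ.pull two.op) a) a := hyp
  exact DFunLike.congr_fun (h' H) a

/-! ### §4 Row F-2808 at `Ψ = 𝟭` -/

/-- The base is of FSM-type (all its arrows are isomorphisms), hence of FSMFF-type.
[cite: MochizukiFrdI2008, §0 p.18] -/
theorem isOfFSMFFType_base : IsOfFSMFFType Base :=
  IsOfFSMType.isOfFSMFFType ⟨fun f _ => isIso_base f⟩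

/-- **The standing hypotheses of Cor. 3.8 hold** for `C₁ = C₂ := C`, `Ψ := 𝟭`: FSMFF base, and "`Φ`
non-dilating" AS TYPED (the vocabulary stub reads `True`). [cite: MochizukiEtTh2009, Cor 3.8 p.80] -/
def hyp : Cor38Hyp C C where
  Ψ := .refl
  fsmff := ⟨isOfFSMFFType_base, isOfFSMFFType_base⟩
  nonDilating := ⟨fun _ _ => trivial, fun _ _ => trivial⟩

/-- `C.opsData` is NOT of standard type: clause (e) "`Φ` non-dilating" of [FrdI] Def. 3.1 (i) fails at the
automorphism `2`. [cite: MochizukiFrdI2008, Def. 3.1 (i) p.56] -/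
theorem not_isOfStandardType : ¬ C.opsData.IsOfStandardType := fun h =>
  not_isNonDilating_pull_two (h.nonDilating.nonDilating (SingleObj.star NNRatˣ) two)

/-- **F-2808 fails at `hyp`**: the two (equal) tempered Frobenioids of the record are NOT "of standard and
isotropic type, but not of group-like type" — standard type fails. [cite: MochizukiEtTh2009, Cor 3.8 p.81] -/
theorem not_standardIsotropicNotGroupLike : ¬ hyp.StandardIsotropicNotGroupLike :=
  fun h => not_isOfStandardType h.standard.1

end DilatingToy

/-- **F-2808 as typed is not a fact over ALL `Cor38Hyp` records:** the closure (universe level `0`) is FALSE —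
the record's "`Φ` non-dilating" is a vocabulary stub, not [FrdI]'s predicate.  Instance forms:
`Cor38Hyp.standardIsotropicNotGroupLike_treeCatVocab`, `standardIsotropicNotGroupLike_of_hypotheses`.
[cite: MochizukiEtTh2009, Cor 3.8 p.81] -/
theorem Cor38Hyp.not_forall_standardIsotropicNotGroupLike :
    ¬ ∀ {D₀ : Type} [Category.{0} D₀] {V : FrdIMonoidStub.{0}} {T : RealifiedDivisorMonoids (D₀ := D₀) V}
        {D : Type} [Category.{0} D] {VD : FrdICatStub.{0, 0, 0} D}
        {D₀' : Type} [Category.{0} D₀'] {T' : RealifiedDivisorMonoids (D₀ := D₀') V}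
        {D' : Type} [Category.{0} D'] {VD' : FrdICatStub.{0, 0, 0} D'}
        {C₁ : TemperedFrobenioid T D VD} {C₂ : TemperedFrobenioid T' D' VD'} (h : Cor38Hyp C₁ C₂),
        h.StandardIsotropicNotGroupLike :=
  fun h => DilatingToy.not_standardIsotropicNotGroupLike (h DilatingToy.hyp)

end Literature.AnabelianGeometry.EtaleTheta

end
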